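import Summits.BirchSwinnertonDyer.Rank1Residual.X11b.ShapiroPairs
import HarnessLib

/-!
# BSD rank-≤1 residual cell, good SUPERSINGULAR reduction at `p = 3`, rank ONE, `#Ш_an` a `3`-adic UNIT, `ρ̄_{E,3}` SURJECTIVE
# — family X7Three (class X7 at `p = 3`, `a_3 = 0`, class-closure cell O4@3): `BSD(E,3)` per pair from PUBLISHED theorems + ONE two-engine EXACT 3-descent certificate line — batch 12

HONEST FRAMING (cell `b2b-bsdres-*`, verbatim): prove what is provable now; shrink each hard class to its core with data;
no claim beyond stated classes; COMBINATION classes deleted from PUBLISHED theorems only, CONSTRUCTION-shaped remainder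
typed; this is not "finishing BSD". X8 / X7 stay CONSTRUCTION-SHAPED; everything here is PER PAIR; no lane verdict is
changed; no named fact; nothing is booked by this unit (OFFER — the owners / the lane / referee A decide). Unit
`b2b-bsdres-additive-p3` GEN 30 (prover-b2b-bsdres-additive-p3-g30-0; X8 prover B, CLASS-CLOSURE class lead N6·O3, X7
joint pair B side), successor fold of campaign 'R1U-TAIL-28 EXACT' = `EFFICIENCY.md` §7 ADDENDUM B (dated before its ids, l.232;
cc-lead GEN 73 SIGNED Tier I, l.233; ids j175260–j175319 submitted by GEN 28) and ADDENDUM C (l.234; Tier IIa signed cc-lead GEN 80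
l.235, sized census GEN 34 PASS 8, bought lit GEN 103 l.15010; ids j192135–j192187 submitted by GEN 29, pre-registered `P-ADDP3-IIa`),
all running past the submitting seats: the capped NOT-RUN rows of GEN 27's 'P3-R1-UNIT TAIL' (addendum A) re-bought as single-row
EXACT legs on BOTH engines (kits byte-identical to GEN 27's; walls 2 × (Tier I) / 1.35 × + 1 h (Tier IIa) the x11b disc(A)-law
prediction), folded unchanged by GEN 30's `refold30.py` (= GEN 27's `gen_records_r1u.py` fold, re-pointed); the ONE GRH-mode
engine-2 cross-check id per certified pair (GEN 29's / this seat's) transports engine 1's certificate (`JOB_E1DIR`).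

WHY (class lead O3, gen 27–30): at referee A's ROUND 203 the cells O3 (X8 r = 1) and O4@3 (X7 r = 1, p = 3) still held
200 OPEN rank-one cells with `#Ш_an` a `3`-unit and surjective `ρ̄_{E,3}` (obsanat `class-closure/O3|O4/pairs-openA-R203.tsv`).
They are open in engine A because no booked campaign of record had certified them: they are EXACTLY the tails of harvest-1's
T-full3 BEYOND-THE-WINDOW campaign (`b2b-bsdres-harvest-1/g25/full3r1_bw/`: ONE-ENGINE-EXACT 122 or NOT-RUN 29 — wall-time
tails, not errors) plus 49 window cells (`N < 2·10⁴`) that sat in no descent population. (Population datum, corrected per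
census-lead GEN 30 l.13447: `3 ∣ ∏ c_ℓ` on 174 of the 200 — all 52 O3 rows and 122 of the 148 O4@3 rows; the other 26
O4@3 rows have `3 ∤ ∏ c_ℓ`; the Tamagawa number plays no role in the consumer below.) On such a row the
`3`-part of BSD is the statement `Ш(E/ℚ)[3] = 0`, and the tree's CLASS-FREE consumer
`Typed.bsdp_of_card_selmerGroup_eq_pow_analyticRank` (GZK + `r_an ≤ 1` + `3 ∤ #Ш_an` + the ONE line `#Sel^(3)(E/ℚ) = 3^{r_an}`;
NO image hypothesis, NO Tamagawa condition — the Tamagawa factor sits inside `#Ш_an`) closes it from an exact `3`-descent —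
the F3BW / F3BW2 currency referee A booked at R198.17 / R202.3 for harvest-1's TWO-ENGINE rows.

ENGINE CREDIT (both engines RUN UNCHANGED; only curve lists are new): ENGINE 1 = unit `b2b-bsdres-x11b`'s exact-element
3-descent `desc3lib.gp` (Schaefer–Stoll in the octic étale algebra `A = ℚ[x]/(ψ₃)`; sha256 c4fb20b7…) — rows of record from
harvest-1's campaign (sha-2's `jobA_full3` driver `run4_entry_exact3.gp`, jobs `g25/full3r1_bw/jobs_e1/`) where it had
already certified the row, else this unit's run of unit `b2b-bsdres-x11c` GEN 15's kit (`entry.gp` 1efb1f5d…, `main.py`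
78a19635…, `chunk_runner.py` 74b94fe3…) in EXACT mode (`bnfcertify(A,1) = 1` + 3-saturation; Cremona's generator located in
the computed Selmer group); ENGINE 2 = unit `b2b-bsdres-x10b`'s independent `desc3full_e2.py` rev 2 (sha256 43270190…;
relative-quadratic model of `A`, σ-norm rows on the certified quartic, deterministic local grid; harvest-1 g25 kit `main.py`
1cbaa8d3…) in EXACT mode, this unit's jobs, with engine 1's certificate vector transported and checked to span the SAME
`𝔽₃`-subspace of `A^×/A^{×3}` where a certificate was staged. Both: `dim_𝔽₃ Sel^(3)(E/ℚ) = 1 = rank`, i.e. `Ш(E)[3] = 0`.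

What enters the kernel per pair is ONE line: `hSel : #Sel^(3)(E/ℚ) = 3 ^ r_an` of the class-free consumer through x11c gen 12's
`X11b.bsdp_of_ainvs_of_card_selmerGroup` (GZK `hGZK`, `r_an ≤ 1`, `3 ∤ #Ш_an`; `Δ ≠ 0` by `decide`). Non-kernel inputs per pair:
`r_an = 1`, `#Ш_an` (Cremona `allbsd`; the lane's values) and the certificate line (tables `HOME/b2b-bsdres-additive-p3/g27/r1u/fold/R1U-TABLE.tsv`,
the GEN 28 / 29 / 30 re-folds `HOME/b2b-bsdres-additive-p3/g28/r1u/R1U-TABLE.tsv`, `…/g29/r1u/R1U-TABLE.tsv`, `…/g30/r1u/R1U-TABLE.tsv`;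
Tier-I / IIa job dirs `HOME/b2b-bsdres-additive-p3/g29/r1u28/jobs/` and `…/g30/r1u28/jobs/`).
References: Schaefer–Stoll, Trans. AMS 356 (2004) [SchaeferStoll2004]; Silverman, *AEC* X.1, X.4 [SilvermanAEC2009];
Miller, LMS JCM 14 (2011) §1 [Miller2011LMS]; Cremona [Cremona2006].
-/

set_option autoImplicit false

noncomputable section

open scoped Classical

open WeierstrassCurve Literature.NumberTheory.EllipticCurves
  Literature.NumberTheory.EllipticCurves.Rank1Residual
  Literature.NumberTheory.EllipticCurves.Rank1Residual.Typed
  Literature.NumberTheory.EllipticCurves.Rank1Residual.X11RankOneCertificates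
  Summit.BirchSwinnertonDyer.Rank1Residual.X11b

namespace Summit.BirchSwinnertonDyer.Rank1Residual.Supersingular

/-- **`BSD(E,3)` for `340340e1`** [TWO-ENGINE-EXACT] (class X7 at 3, cell O4@3: `N = 340340`, good supersingular at `3`; Cremona model `[0,0,0,-328,-327]`; `ρ̄_{E,3}` surjective; `r_an = 1`, generator `(24,75)`; `#Ш_an = 1` (a `3`-unit), `∏ c_ℓ = 12` (`ord₃ = 1`); open in engine A at R203)
from GZK and the certificate line `#Sel^(3)(E/ℚ) = 3 ^ r_an`: ENGINE 1 (x11b `desc3lib.gp` EXACT; additive-p3 GEN 28 job j175295): `S = {2, 3, 5, 7, 11, 13, 17, 19, 23, 29, 31, 37, 41, 43, 47, 53}`, `Cl(A) = [6, [6]]` CERTIFIED (`bnfcertify = 1`, 3-saturated), `44` generators of `A(S,3)`, `dim H¹(ℚ,E[3];S) = 8`, **`dim Sel^(3)(E/ℚ) = 1 = rank`**, MW `mw:cremona-allgens:rank>=1 pts=1 F(P) in <Sel>`, mode `EXACT(bnfcertify1+3sat)`, 37211547ms; ENGINE 2 (x10b `desc3full_e2.py` EXACT; additive-p3 GEN 28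 job j175297): `|d_A| ≈ 10^24`, `Cl(A) = [6, [6]]`, `Cl_S = [1, []]`, `bnfcertify(A,1) = 1` + 3-saturation, `dim H¹_S = 8`, **`dim Sel^(3) = 1`**, verdict `Sha[3]=0`, MW image rank `1`, 46414.9 s; engine 1's certificate spans the SAME 𝔽₃-subspace (cross-check `True`, j193781) ⟹ **`#Sel^(3)(E/ℚ) = 3^1`**, `Ш(E)[3] = 0`. Kernel: `Δ ≠ 0`. Binders: `hGZK`, `r_an ≤ 1`, `#Ш_an` a `3`-unit, `hSel`. Per pair; OFFER; nothing booked.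
[cite: Miller2011LMS, §1 and Def. 1.1] [cite: Cremona2006, Table 1 (Cremona label 340340e1)] -/
theorem bsdp3_r1u_340340e1 (hGZK : rank_eq_analyticRank_of_analyticRank_le_one)
    (W : WeierstrassCurve ℚ) (hW : W = ⟨0, 0, 0, -328, -327⟩)
    (hr : W.analyticRank ≤ 1) {q : ℚ} (hq : shaAn W = (q : ℂ)) (hv : padicValRat 3 q = 0)
    (hSel : Nat.card (W.selmerGroup (3 : ℤ)) = 3 ^ W.analyticRank) : BSDp W 3 := by
  subst hW
  haveI : Fact (Nat.Prime 3) := ⟨by norm_num⟩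
  exact bsdp_of_ainvs_of_card_selmerGroup hGZK 0 0 0 (-328) (-327) (by decide +kernel) 3 hr hq hv hSel

end Summit.BirchSwinnertonDyer.Rank1Residual.Supersingular

end
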